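import Mathlib
import HarnessLib
import HarnessLib.Audit
import Summits.AnomalousDissipation.Statement
import HarnessLib.Audit.Status.Attr

/-!
Route: CriticalLayer

# Route CriticalLayer — AnomalousDissipation (= Literature.Turb.ZerothLaw), positive side; realises
idea card haberman-critical-layer-absorptivity

## Thesis X (words)
Fix the two-component steady force f = F sin(2πk x₂) e₁ + G sin(2πm x₁) e₂ on T³ (Kolmogorov shear +
a steady OBLIQUE wave at zero
phase speed; smooth, divergence-free and mean-zero for every F, G, k, m). It suffices to show X: for
some F, G and k, m ≥ 1 there are
viscosities ν_j → 0 and global Leray–Hopf solutions u_j driven by f with (i) bounded limsup-mean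
energy, (ii) no Leray–Hopf leakage in the
mean, ⟨(f,u_j)⟩ ≤ ν_j⟨‖∇u_j‖²⟩ (route Correlation's clause, convention limsup of Cesàro means),
(iii) a ν-UNIFORM FLOOR ON THE POWER INJECTED
THROUGH THE OBLIQUE COMPONENT, limsup-mean of G ∫ sin(2πm x₁) u_{j,2} ≥ ε > 0, and (iv) the shear
channel is not a brake: liminf-mean of
F ∫ sin(2πk x₂) u_{j,1} ≥ −ε/2.

## Thesis X (Lean, one line; = item KolmogorovObliqueThesis, elaborated rc 0 in the planner's
Sketch)
Lean: KolmogorovObliqueThesis := ∃ F G k m ν u₀ u, 0<k ∧ 0<m ∧ (∀ j, 0<ν j) ∧ Tendsto ν atTop (nhds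
0) ∧ (∀ j, Torus.IsGlobalLerayHopf (ν j) (fun _ => f_{F,G,k,m}) (u₀ j) (u j)) ∧
(∃ E, ∀ j, meanEnergy (u j) ≤ E) ∧ (∀ j, longTimeAvgSup ⟨f,u j⟩ ≤ meanDissipation (ν j) (u j)) ∧ ∃
ε>0, (∀ j, ε ≤ longTimeAvgSup ⟨g_{G,m}, u j⟩) ∧
(∀ j, −ε/2 ≤ longTimeAvgInf ⟨s_{F,k}, u j⟩), with f_{F,G,k,m} x = (F·Im e^{2πi k x₂})•e₁ + (G·Im
e^{2πi m x₁})•e₂ written with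
UnitAddTorus.mFourier (Pi.single 1 k), EuclideanSpace.single; all constants exist
(Literature.Analysis.FluidPDE.{meanEnergy, meanDissipation,
longTimeAvgSup, longTimeAvgInf, Torus.IsGlobalLerayHopf}).

## Assembly X → AnomalousDissipation (item Assembly)
Time means of the two pairings add (each t ↦ ∫⟪φ, u_j t⟫ is continuous on (0,T] by
IsLerayHopfOn.weak_continuous, hence interval
integrable), limsup(a+b) ≥ limsup b + liminf a gives ⟨(f,u_j)⟩ ≥ ε/2, then (ii) gives
meanDissipation ≥ ε/2; f is smooth, div-free,
mean-zero (item KolmogorovObliqueForceRegular); the data are the u₀ j. Elementary real analysis +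
one regularity lemma on the force.
Cruxes → X (glue added 2026-08-16, route-choice repair): item CruxesGiveThesis :
TurbulentCriticalLayersAbsorb → ShearInjectionSign →
NoMeanLeakage → KolmogorovObliqueForceRegular → LerayHopfSpaceTranslation → KolmogorovObliqueThesis
— (i)+(iii) from the #2 witness,
its F made ≥ 0 by the half-period shift x₂ ↦ x₂ + 1/(2k) (LerayHopfSpaceTranslation), (iv) from #4
with δ = ε/2 after an index shift (F = 0 trivial),
(ii) per j from the named condition #5 NoMeanLeakage (∀-form: zero mean energy defect of every
Leray–Hopf solution under a smooth steady
force). Deciding theorem: closes := Assembly (CruxesGiveThesis …).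

## Mechanism behind (iii) (why this is a line of attack and not a restatement)
The oblique wave sees the turbulent mean shear Ū(x₂)e₁ (≈ A sin(2πk x₂), Re-independent friction
factor in DNS, MusacchioBoffetta2014).
At the critical levels Ū = 0 the steady LINEAR response absorbs a ν-INDEPENDENT power, the
Plemelj/limiting-absorption rate
I(Ū,g) = Σ_{Ū(y_c)=0} |ĝ(y_c)|²/(2m|Ū′(y_c)|), independent of the regulariser (item
PlemeljAbsorption: a theorem of 1-D linear analysis,
inner Airy/Scorer layer of width (ν/(2πm|Ū′_c|))^{1/3}, ∫Re = π). In 2-D the nonlinear cat's eye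
shuts the absorber off (Haberman's
parameter λ ∝ ν → 0; Killworth–McIntyre absorptivity bound) — item PlanarCatsEyeDodging is the
planar no-go with this force; in 3-D
the cat's-eye row is inviscidly unstable and the turbulent layer acts as an eddy-viscous absorber
with λ_T = O(1), so injection ≥ θ·I
uniformly in ν — item TurbulentCriticalLayersAbsorb (the crux). Whether the forced shear mode can
act as an O(1) brake (negative
effective viscosity / over-reflection) is isolated as item ShearInjectionSign.

Rationale: WHY THIS LINE. Every positive route on the ledger (Correlation, CoherentStates, Ensemble,
EulerLimit, TwoAndHalfD) leaves the INJECTION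
MECHANISM unnamed: Correlation.CorrelationPersistence (0201) asks for ⟨(f,u_j)⟩ ≥ ε with no handle
on why a fixed smooth force keeps doing
O(1) work on an ever rougher flow. Linear theory already owns one ν-independent dissipation rate in
all of fluid mechanics: absorption of a
steady wave at a critical level (Booker–Bretherton doi:10.1017/s0022112067000515, Haberman
doi:10.1002/sapm1972512139, Tollmien/Lin viscous
critical layer of width (αR)^{-1/3}, book:drazin2002-introduction-hydrodynamic-stability pp.126–127;
limiting absorption for Kolmogorov
flow arXiv:1711.01822, arXiv:2001.03087; steady source in a sine shear: κ⟨|∇θ|²⟩ → const, variance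
~Pe^{1/3}, arXiv:physics/0607270 §VI).
Import (GFD/hydrodynamic stability → zeroth law), dictionary: steady oblique force component ↦
stationary wave of phase speed 0;
turbulent mean profile Ū ↦ basic flow; injected power ↦ critical-layer absorptivity; 2-D no-go
(AlexakisDoering2006PLA) ↦ cat's-eye
saturation λ ∝ ν (doi:10.1017/s0022112085003019); 3-D zeroth law ↦ Haberman's λ evaluated with the
eddy viscosity stays O(1).
The force class is the DNS workhorse (Kolmogorov flow, MusacchioBoffetta2014 = arXiv:1401.5935:
Re-independent friction), so every
crux is checkable by kit compute before anyone proves anything.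
RANKED CRUXES. #2 TurbulentCriticalLayersAbsorb (hardest; the bet): bounded-energy LH family for
f_{F,G,k,m} with a ν-uniform floor on
the OBLIQUE injection. #3 PlanarCatsEyeDodging: in the x₃-invariant class the oblique injection → 0
(limsup and liminf means) — the 2-D
face; plausible via Alexakis–Doering (total planar injection → 0) but NOT implied by it (cancelling
channels). #4 ShearInjectionSign:
for every bounded-energy LH family with F > 0 the liminf-mean shear injection is ≥ −δ eventually in
j (no O(1) brake) — needed to pass
from (iii) to total injection; dubious enough (negative eddy viscosity, over-reflection) to be a
crux, cheap enough to be decided first.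
#5 NoMeanLeakage (CONDITION of the line, staff last; added 2026-08-16 by the route-choice repair):
clause (ii) of X in ∀-form —
every global Leray–Hopf solution under a smooth steady div-free mean-zero force has limsup-mean
injection ≤ limsup-mean viscous dissipation
(zero mean energy defect; FoiasManleyRosaTemam2001 p.71 and RobinsonRodrigoSadowski2016 §4.3 p.78:
open even as an inequality for general weak
solutions; implied by fixed-ν regularity, strictly weaker); it is what turns the injection floor
(iii)+(iv) into the summit's dissipation floor,
and it is shared in substance by every Leray–Hopf-based positive route
(Correlation.BoundedEnergyEquality 0202 is its ∃-form). GLUE (support):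
CruxesGiveThesis : #2 → #4 → #5 → KolmogorovObliqueForceRegular → LerayHopfSpaceTranslation →
KolmogorovObliqueThesis (sign of F normalised by the
half-period shift x₂ ↦ x₂ + 1/(2k), F = 0 trivial, δ = ε/2 in #4, index shift j ↦ j+J, (ii) per j
from #5); deciding theorem closes := Assembly ∘ CruxesGiveThesis.
SUPPORT (provable now): PlemeljAbsorption (1-D LAP lemma, constant (π/|a|)Σ|g(y_c)|²/|U′(y_c)|;
shared verbatim with route
SweepRigidity, where the same lemma explains why frozen steady states need unbounded energy to
dissipate); KolmogorovObliqueForceRegular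
(smooth/div-free/mean-zero); MeanMomentumBalanceShearMode (exact Banach-limit momentum balance of
the forced shear mode:
4π²k²ν⟨(s,u)⟩_Λ − 2πkF⟨∫u₁u₂cos⟩_Λ = F²/2, the tool for #4 and for DNS diagnostics);
LerayHopfSpaceTranslation (space-translation
covariance of torus Leray–Hopf solutions, folklore not yet in tree — only time translates and the R³
bounded-weak class are); CruxesGiveThesis (the glue above).
KILL CRITERIA. #3 refuted with an explicit planar family absorbing O(1) power through g at bounded
energy ⇒ the 2-D/3-D dichotomy is
wrong and the mechanism void: close. #4 refuted (an O(1) brake) does not close the route but forces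
X to carry the total-injection floor
(then X = Correlation.X specialised, and the route is superseded by Correlation). A theorem
"bounded-energy LH families for f_{F,G,k,m}
have ⟨(g,u_j)⟩ → 0" (3-D decorrelation in this class, cf. Neg.Decorrelation) closes the route.
#5 refuted (a Leray–Hopf solution with an energy sink of positive time-density at fixed ν > 0) kills
clause (ii) for EVERY Leray–Hopf family
of every positive route at once: X must then be re-read on energy-equality (classical /
time-periodic) families — pivot to the CoherentStates reading of (ii),
new glue, mechanism untouched.
NOT DECOMPOSED YET. The VALUE θ·I(Ū_j,g) (needs a mean profile: Banach-limit means,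
GeneralizedLimit); Orr–Sommerfeld (vector) version
of PlemeljAbsorption with Tollmien's correction; nonlinear critical-layer theory (Haberman Φ(λ));
3-D instability of Kelvin–Stuart
cat's eyes (Pierrehumbert–Widnall) as the ignition statement; which (k,m) (k ≥ 2 to leave
Marchioro/Meshalkin–Sinai rigidity).
CHEAPEST FALSIFIER. One planar (x₃-invariant) long-time computation of 2-D NS driven by f_{F,G,k,m}
in the regime m > k, |G| ≫ F
(Meshalkin–Sinai pumping of the shear channel, Frisch1995 §9.6.3 (9.59)–(9.60)): an O(1)-in-ν
OBLIQUE injection floor at bounded energy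
paid for by an anti-phase shear brake refutes PlanarCatsEyeDodging AND ShearInjectionSign together
(kit compute, 2-D pseudo-spectral,
ν halved ×4; identified by retriage gen-3). For the bet itself: 3-D DNS of Kolmogorov flow + one
oblique mode (MusacchioBoffetta2014 =
arXiv:1401.5935 set-up) at Re doubled ×3 — the oblique injection G⟨∫ sin(2πm x₁)u₂⟩ must plateau,
not decay like Re^{-α}
(α ≈ 0.05, arXiv:2504.13298); a clean decay retires TurbulentCriticalLayersAbsorb before anyone
proves anything.

Novelty: Searched 2026-08-15 (this planner): `lit search` x3 (searchd rc 75 = off-box service down all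
session, recorded), `lit vsearch` x3
(hit: book:drazin2002-introduction-hydrodynamic-stability pp.126-127, READ: Tollmien critical layer,
width (alpha R)^{-1/3}, Airy inner
solutions, branch from c_i -> 0+), `lit galaxy search "critical layer absorption" --star pdf` (6
hits, all GFD gravity-wave drag /
atmosphere-ocean, none on body-forced turbulence), `lit galaxy search "Prandtl-Batchelor" --star
pdf`; plus the card's three
refuter novelty audits of 2026-08-15 (06:47Z, 08:04Z, 10:29Z: galaxy intelligent x3, crossref x20,
arXiv, hub grep of 109 cards).
Nearest prior art actually found: (1) regulariser-free critical-level absorption and its nonlinear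
shut-off: doi:10.1017/s0022112067000515
(Booker-Bretherton 1967), doi:10.1002/sapm1972512139 (Haberman 1972: lambda, Phi(lambda)),
doi:10.1017/s0022112085003019
(Killworth-McIntyre 1985: 2-D absorptivity bound), doi:10.1017/s0022112099007326 (Le Dizes 2000:
steadily forced 2-D vortex, response
decided by Haberman's h), doi:10.1017/s0022112096007549 (van Duin 1996: critical layer in a
TURBULENT profile with eddy viscosity);
(2) the scalar Plemelj lemma in the exact sine-shear geometry: arXiv:physics/0607270 sec. VI
(Shaw-Thiffeault-Doering 2007: steady
source, layers Pe^{-1/3} at zeros of u, kappa<|grad theta|^2> -> const); (2b) O(1) critical-layer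
absorption of steady KOLMOGOROV forcing by a cross-flow, computed: ChildressKerswellGilbert2  [refs: 10.1017/s0022112067000515, 10.1002/sapm1972512139, 10.1017/s0022112085003019, 10.1017/s0022112099007326, 10.1017/s0022112096007549, 10.1016/s0167-2789(01, 10.1103/physreve.89.023004, physics/0607270, 1711.01822, 2001.03087, 1401.5935, book:drazin2002-introduction-hydrodynamic-stability, doi:10.1017/s0022112067000515, doi:10.1002/sapm1972512139, doi:10.1017/s0022112085003019, doi:10.1017/s002211209]

Barriers (technique_class: limiting-absorption critical-layer kolmogorov-type-forcing): technique_class: limiting-absorption critical-layer kolmogorov-type-forcing (also: linear-response,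
long-time-averages)
- Literature.Barriers.AnomalousDissipation.Marchioro1986_globalAttraction [kolmogorov-type-forcing,
first-mode, 2-D]: APPLIES to the
  choice of (k,m): gravest-mode shear forcing is globally laminar in 2-D and linearly stable on the
unit 3-torus (Meshalkin-Sinai band
  empty); EVADED by construction — every exists-item leaves k,m free (the prover takes k >= 2 or
relies on subcritical 3-D transition),
  every forall-item (PlanarCatsEyeDodging, ShearInjectionSign) is consistent with the laminar branch
(oblique injection of the laminar
  2-D state is O(nu); shear injection there is positive).
- Literature.Barriers.AnomalousDissipation.Cheskidov2023_thm13_not_forceRobustNoAnomaly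
[long-time-averages, neg-route, force-robust]:
  constrains NEGATIVE statements proved by force-robust energy estimates. The two forall-items here
are not no-anomaly claims:
  PlanarCatsEyeDodging lives in the x3-invariant class where the planar velocity obeys
Alexakis-Doering exactly (the barrier's own
  witnesses are 2.5-D with the anomaly in the PASSIVE third component, which carries no injection
for this force: f has no e3 part),
  and ShearInjectionSign is a sign statement about one Fourier mode, to be proved from the exact
momentum balance of that mode
  (MeanMomentumBalanceShearMode), which uses the precise steady force, not an L2-neighbourhood of
it. The positive items are outsi

History (route lifecycle, newest last):
- 2026-08-16T03:26:50Z · rev 11: dropped LerayHopfNoMeanLeakage, ShearInjectionSignAllSigns, ShearSignSymmetry, ThesisGlue — @dropA_note.txt (planner-rbadge-AnomalousDissipation-CriticalLa-b0f27859-0)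
- 2026-08-16T03:41:18Z · AUTO-CRUX (backfill): KolmogorovObliqueThesis — hypotheses of the deciding theorem that nothing in the route derives are cruxes (operator:999:586464)
- 2026-08-24T01:28:23Z · DORMANT — reconciler: no traction for 6.4 d (last activity item-evidence-added at 2026-08-17T14:55:53Z); parked, not closed — `ledger route dormant route-AnomalousDissipa (operator:999:1827502)
- 2026-08-31T10:55:19Z · REACTIVATED (open) — reconciler: reactivated — activity statement-checked at 2026-08-31T09:58:29Z after parking at 2026-08-24T01:28:23Z (operator:999:1780616)

sub-problem: AnomalousDissipation · status: open · opened planner-plancards-AnomalousDissipation-AnomalousDissipation-20260815w1-1-0 2026-08-15T10:39:23Z · rev 11 · ledger route-AnomalousDissipation-CriticalLayer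
GENERATED by the gate from the ledger (D-0016/17). Provers cite these decls: `theorem foo : Summit.AnomalousDissipation.AnomalousDissipation.Theses.CriticalLayer.<Decl> := …` in Summits/AnomalousDissipation/AnomalousDissipation/Theorems/<Name>.lean.
-/

namespace Summit.AnomalousDissipation.AnomalousDissipation.Theses.CriticalLayer

open scoped BigOperators Topology Manifold Classical MeasureTheory ProbabilityTheory Matrix InnerProductSpace ComplexConjugate ContinuousMap
open Filter Set Function TopologicalSpace MeasureTheory

attribute [summit_statement] _root_.AnomalousDissipation

open Literature.Turb

/-- item stmt-AnomalousDissipation-1010 · crux (kind.auto-crux: conjecture-grade) · rank 0 · open · by planner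
why it might fail: Conjunction on ONE family: clause (ii) (no LH leakage in the mean; 3-D energy equality open) is carried by no item; (iii) dies under a WEAK anomaly ε~Re^{-α}, α≈0.05 (IDES 2025) or re-laminarised/reflecting critical layers (CKG2001 §6: u=O(G^{1/6})); (iv) under an MS negative-viscosity brake (m>k).
sources: arXiv:2504.13298 (Iyer–Drivas–Eyink–Sreenivasan 2025, 'Whither the Zeroth Law of Turbulence?': periodic-box DNS, D=O(Re^{-α}) with α ≥ 3(ζ₃−1)/(3+ζ₃)=0.0487 — weak dissipative anomaly), ChildressKerswellGilbert2001 §6.1–6.2 pp.123–125 (doi:10.1016/s0167-2789(01)00320-7: critical-layer absorption of Kolmogorov forcing by a cross-flow, O(1) rate π|w_y(y₀)|⁻¹ but u=O(G^{1/6}) in layers O(G^{-1/6})), FoiasManleyRosaTemam2001 p.71 (energy equality for 3-D weak solutions unknown) — clause (ii), Cheskidov2023 = arXiv:2311.04182 §1.2 (long-time-average framework; no known bounded-energy example at fixed force), DoeringFoias2002 §2 (long-time averages, injection = dissipation budget for regular solutions), Frisch1995 §9.6.3 eqs (9.59)–(9.60) (Kolmogorov flow (0, sin x₁): ν_E = ν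 − 1/(2ν) for large-scale perturbations perpendicular to the basic flow; Meshalkin–Sinai instability) — clause (iv)
[target] Thesis X of route CriticalLayer (card haberman-critical-layer-absorptivity): for the force
f = F sin(2πk x₂)e₁ + G sin(2πm x₁)e₂ there is a bounded-energy, leak-free (⟨(f,u)⟩ ≤
meanDissipation) global Leray–Hopf family at ν_j → 0 whose OBLIQUE injection limsup-mean G∫sin(2πm
x₁)u₂ ≥ ε and whose shear injection liminf-mean ≥ −ε/2. Conventions as in Literature.Turb.ZerothLaw
(limsup of Cesàro means) and route Correlation (pairing inner ℝ (f x) (u j t x)). -/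
@[route_item "route-AnomalousDissipation-CriticalLayer", crux]
def KolmogorovObliqueThesis : Prop :=
  ∃ (F G : ℝ) (k m : ℕ) (ν : ℕ → ℝ) (u₀ : ℕ → UnitAddTorus (Fin 3) → EuclideanSpace ℝ (Fin 3)) (u : ℕ → ℝ → UnitAddTorus (Fin 3) → EuclideanSpace ℝ (Fin 3)), 0 < k ∧ 0 < m ∧ (∀ j, 0 < ν j) ∧ Filter.Tendsto ν Filter.atTop (nhds 0) ∧ (∀ j, Literature.Analysis.FluidPDE.Torus.IsGlobalLerayHopf (ν j) (fun _ => (fun x : UnitAddTorus (Fin 3) => (F * (UnitAddTorus.mFourier (Pi.single (1 : Fin 3) (k : ℤ)) x).im) • (EuclideanSpace.single (0 : Fin 3) (1 : ℝ) : EuclideanSpace ℝ (Fin 3)) + (G * (UnitAddTorus.mFourier (Pi.single (0 : Fin 3) (m : ℤ)) x).im) • (EuclideanSpace.single (1 : Fin 3) (1 : ℝ) : EuclideanSpace ℝ (Fin 3)))) (u₀ j) (u j)) ∧ (∃ E : ℝ, ∀ j, Literature.Analysis.FluidPDE.meanEnergy (u j) ≤ E) ∧ (∀ j, Literature.Analysis.FluidPDE.longTimeAvgSup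 (fun t => MeasureTheory.integral MeasureTheory.volume (fun x => inner ℝ ((fun x : UnitAddTorus (Fin 3) => (F * (UnitAddTorus.mFourier (Pi.single (1 : Fin 3) (k : ℤ)) x).im) • (EuclideanSpace.single (0 : Fin 3) (1 : ℝ) : EuclideanSpace ℝ (Fin 3)) + (G * (UnitAddTorus.mFourier (Pi.single (0 : Fin 3) (m : ℤ)) x).im) • (EuclideanSpace.single (1 : Fin 3) (1 : ℝ) : EuclideanSpace ℝ (Fin 3))) x) (u j t x))) ≤ Literature.Analysis.FluidPDE.meanDissipation (ν j) (u j)) ∧ ∃ ε : ℝ, 0 < ε ∧ (∀ j, ε ≤ Literature.Analysis.FluidPDE.longTimeAvgSup (fun t => MeasureTheory.integral MeasureTheory.volume (fun x => inner ℝ ((fun x : UnitAddTorus (Fin 3) => (G * (UnitAddTorus.mFourier (Pi.single (0 : Fin 3) (m : ℤ)) x).im) • (EuclideanSpace.single (1 : Fin 3) (1 : ℝ) : EuclideanSpace ℝ (Fin 3))) x) (u j t x)))) ∧ (∀ j, -(ε / 2) ≤ Literature.Analysis.FluidPDE.longTimeAvgInf (fun t => MeasureTheory.integral MeasureTheory.volume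 (fun x => inner ℝ ((fun x : UnitAddTorus (Fin 3) => (F * (UnitAddTorus.mFourier (Pi.single (1 : Fin 3) (k : ℤ)) x).im) • (EuclideanSpace.single (0 : Fin 3) (1 : ℝ) : EuclideanSpace ℝ (Fin 3))) x) (u j t x))))

/-- item stmt-AnomalousDissipation-1011 · crux · rank 2 · open · by planner
why it might fail: A ν-uniform oblique-injection floor at bounded energy IS the zeroth law for this force class: periodic-box DNS favours a weak anomaly ε~Re^{-α}, α≈0.05 (IDES 2025); the one computed Kolmogorov-force critical-layer absorber (CKG2001 §6) pays u=O(G^{1/6}), energy ∝ν^{-1/3}; λ_T(ν)→0 kills the floor.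
sources: ChildressKerswellGilbert2001 §6.1–6.2 pp.123–125 (model w(y)u_z − G^{-1/2}Δu = sin z: O(1) D_u = π|w_y(y₀)|⁻¹ from critical layers |y−y₀| ≤ O(G^{-1/6}) with u = O(G^{1/6}); 'we do not propose this structure as dominating in the full problem'), arXiv:2504.13298 (Iyer–Drivas–Eyink–Sreenivasan 2025: periodic-box DNS, weak dissipative anomaly D=O(Re^{-α}), α ≥ 0.0487), doi:10.1002/sapm1972512139 (Haberman 1972: nonlinear critical layer, λ = viscosity/nonlinearity ratio, phase jump Φ(λ) from −π (viscous, absorbing) to 0 (nonlinear cat's eye, reflecting)), doi:10.1017/s0022112085003019 (Killworth–McIntyre 1985: do critical layers absorb, reflect or over-reflect? 2-D absorptivity bound), doi:10.1017/s0022112096007549 (van Duin 1996, JFM 320: Miles critical layer in a TURBULENT wind profile closed with an eddy viscosity; held paper:galaxy-pdf-2855942706407144160), Churilov–Shukhman 1995, J. Fluid Mech. 291 (three-dimensional disturbances to a mixing layer in the nonlinear critical-layer regime; galaxy pdf:-7922817968410589200) — the 3-D ignition of the cat's-eye layer the bet relies on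
[crux] TURBULENT CRITICAL LAYERS ABSORB (card C3, exists-θ form per refuter sharpening): ∃ F G, k m
≥ 1, ν_j → 0, a global Leray–Hopf family for f_{F,G,k,m} with bounded limsup-mean energy and a
ν-uniform floor ε on the limsup-mean OBLIQUE injection G∫ sin(2πm x₁) u_{j,2}. Mechanism: the
oblique steady wave is absorbed at the critical levels Ū=0 of the turbulent mean shear at the
Plemelj rate I(Ū,g)=Σ|ĝ(y_c)|²/(2m|Ū′(y_c)|) (PlemeljAbsorption) as long as the eddy-viscous
Haberman parameter λ_T stays O(1); k ≥ 2 (or subcritical 3-D transition) to leave the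
Marchioro/Meshalkin–Sinai rigid regime. Checkable by DNS of Kolmogorov flow with an added oblique
mode (kit compute) before proof. -/
@[route_item "route-AnomalousDissipation-CriticalLayer", crux]
def TurbulentCriticalLayersAbsorb : Prop :=
  ∃ (F G : ℝ) (k m : ℕ) (ν : ℕ → ℝ) (u₀ : ℕ → UnitAddTorus (Fin 3) → EuclideanSpace ℝ (Fin 3)) (u : ℕ → ℝ → UnitAddTorus (Fin 3) → EuclideanSpace ℝ (Fin 3)), 0 < k ∧ 0 < m ∧ (∀ j, 0 < ν j) ∧ Filter.Tendsto ν Filter.atTop (nhds 0) ∧ (∀ j, Literature.Analysis.FluidPDE.Torus.IsGlobalLerayHopf (ν j) (fun _ => (fun x : UnitAddTorus (Fin 3) => (F * (UnitAddTorus.mFourier (Pi.single (1 : Fin 3) (k : ℤ)) x).im) • (EuclideanSpace.single (0 : Fin 3) (1 : ℝ) : EuclideanSpace ℝ (Fin 3)) + (G * (UnitAddTorus.mFourier (Pi.single (0 : Fin 3) (m : ℤ)) x).im) • (EuclideanSpace.single (1 : Fin 3) (1 : ℝ) : EuclideanSpace ℝ (Fin 3)))) (u₀ j) (u j)) ∧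 (∃ E : ℝ, ∀ j, Literature.Analysis.FluidPDE.meanEnergy (u j) ≤ E) ∧ ∃ ε : ℝ, 0 < ε ∧ ∀ j, ε ≤ Literature.Analysis.FluidPDE.longTimeAvgSup (fun t => MeasureTheory.integral MeasureTheory.volume (fun x => inner ℝ ((fun x : UnitAddTorus (Fin 3) => (G * (UnitAddTorus.mFourier (Pi.single (0 : Fin 3) (m : ℤ)) x).im) • (EuclideanSpace.single (1 : Fin 3) (1 : ℝ) : EuclideanSpace ℝ (Fin 3))) x) (u j t x)))

/-- item stmt-AnomalousDissipation-1012 · crux · rank 3 · open · by planner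
why it might fail: Planar budgets P_s+P_o→0 (Alexakis–Doering) and χ=4π²(k²P_s+m²P_o)≥0 fix ONE sign of P_o per regime (none if k=m); a 2-D inverse-cascade state 'motor at the higher forced wavenumber, brake at the lower' (m>k: O(1) oblique motor + MS-pumped anti-phase shear brake; m<k: oblique brake) breaks it.
sources: AlexakisDoering2006PLA §2 (enstrophy production–dissipation balance χ = ν⟨|∇ω|²⟩ = ⟨ω curl f⟩; ε² ≤ νU²χ) and §4 (single-shell forcing: χ = k_f²ε, ε ≤ νk_f²U²), Literature.Barriers.AnomalousDissipation.AlexakisDoering2006_energyDissipationBound (total planar injection → 0 at bounded U, U_j > 0; stated on T² for F·Φ(x/ℓ) — the x₃-invariant two-mode case must be re-derived, routine), Literature.Analysis.FluidPDE.alexakis_doering_enstrophy_bound (χ ≲ k_f³U³ uniformly in Re: enstrophy MAY cascade forward, so χ need not → 0), Frisch1995 §9.6.3 eqs (9.59)–(9.60) + fn 51 (Kolmogorov flow (0, sin x₁) = geometry of the oblique component: ν_E = ν − 1/(2ν) < 0 for large-scale modes with velocity ⟂ basic flow, i.e. W(x₂)e₁ ⊇ the shear channel for k < m; Meshalkin–Sinai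 1961), MeshalkinSinai1961 (doi:10.1016/0021-8928(62)90149-1: long-wave instability of the Kolmogorov flow, unstable band α < forcing wavenumber), doi:10.1103/PhysRevFluids.9.064605 (Xu–van Kan–Liu–Knobloch 2024, PRFluids 9:064605, abstract+§I read: planar inverse cascade in a periodic box condenses into large-scale VORTICES at aspect ratio ≈1, JETS = shear modes at δ≳1.1, bistable; the mode a planar cascade feeds is geometry-selected)
[crux] PLANAR CAT'S-EYE DODGING (card C2, rate dropped): for every F G, k m ≥ 1 and every
x₃-invariant bounded-energy global LH family driven by f_{F,G,k,m} (the planar class: (u₁,u₂) solve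
2-D NS with the in-plane force), the oblique injection vanishes as ν_j → 0 in both limsup- and
liminf-mean. Total planar injection → 0 is Alexakis–Doering (barrier decl
AlexakisDoering2006_energyDissipationBound, ε ≲ ν^{1/2}); the crux is channel-wise: no O(1)
cancellation between an absorbing oblique channel and a braking shear channel. Physical picture:
nonlinear cat's eyes, Haberman λ ∝ ν → 0, Killworth–McIntyre absorptivity bound; 2-D DNS (kit) can
probe it cheaply. -/
@[route_item "route-AnomalousDissipation-CriticalLayer", crux]
def PlanarCatsEyeDodging : Prop :=
  ∀ (F G : ℝ) (k m : ℕ) (ν : ℕ → ℝ) (u₀ : ℕ → UnitAddTorus (Fin 3) → EuclideanSpace ℝ (Fin 3)) (u : ℕ → ℝ → UnitAddTorus (Fin 3) → EuclideanSpace ℝ (Fin 3)), 0 < k → 0 < m → (∀ j, 0 < ν j) → Filter.Tendsto ν Filter.atTop (nhds 0) → (∀ j, Literature.Analysis.FluidPDE.Torus.IsGlobalLerayHopf (ν j) (fun _ => (fun x : UnitAddTorus (Fin 3) => (F * (UnitAddTorus.mFourier (Pi.single (1 : Fin 3) (k : ℤ)) x).im) • (EuclideanSpace.single (0 : Fin 3)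 (1 : ℝ) : EuclideanSpace ℝ (Fin 3)) + (G * (UnitAddTorus.mFourier (Pi.single (0 : Fin 3) (m : ℤ)) x).im) • (EuclideanSpace.single (1 : Fin 3) (1 : ℝ) : EuclideanSpace ℝ (Fin 3)))) (u₀ j) (u j)) → (∀ j t (s : UnitAddCircle) (x : UnitAddTorus (Fin 3)), u j t (x + Pi.single (2 : Fin 3) s) = u j t x) → (∃ E : ℝ, ∀ j, Literature.Analysis.FluidPDE.meanEnergy (u j) ≤ E) → Filter.Tendsto (fun j => Literature.Analysis.FluidPDE.longTimeAvgSup (fun t => MeasureTheory.integral MeasureTheory.volume (fun x => inner ℝ ((fun x : UnitAddTorus (Fin 3) => (G * (UnitAddTorus.mFourier (Pi.single (0 : Fin 3) (m : ℤ)) x).im) • (EuclideanSpace.single (1 : Fin 3) (1 : ℝ) : EuclideanSpace ℝ (Fin 3))) x) (u j t x)))) Filter.atTop (nhds 0) ∧ Filter.Tendsto (fun j => Literature.Analysis.FluidPDE.longTimeAvgInf (fun t => MeasureTheory.integral MeasureTheory.volume (fun x => inner ℝ ((fun x : UnitAddTorus (Fin 3) => (G * (UnitAddTorus.mFourier (Pi.single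 (0 : Fin 3) (m : ℤ)) x).im) • (EuclideanSpace.single (1 : Fin 3) (1 : ℝ) : EuclideanSpace ℝ (Fin 3))) x) (u j t x)))) Filter.atTop (nhds 0)

/-- item stmt-AnomalousDissipation-1013 · crux · rank 4 · open · by planner
why it might fail: Regime m>k, |G|≫F: the G-driven Kolmogorov flow ∝sin(2πmx₁)e₂ has ν_E=ν−1/(2ν)<0 for large-scale modes W(x₂)e₁ (Frisch1995 (9.60); Meshalkin–Sinai): pumps the shear channel, whose phase F does not set; anti-phase locking = O(1) brake (−2πkF⟨∫u₁u₂cos⟩>F²/2). One planar m>k witness kills 1012+1013.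
sources: Frisch1995 §9.6.3 eqs (9.56)–(9.60) (book:frisch1995-turbulence-legacy-n-kolmogorov chunks 183–185: AKA effect; 'the eddy viscosity need not be positive'; Kolmogorov flow (0, sin x₁): ν_E = ν − 1/(2ν) for large-scale perturbations perpendicular to the basic flow, unstable for ν<1/√2; complex in 3-D), MeshalkinSinai1961 (doi:10.1016/0021-8928(62)90149-1: large-scale instability of the Kolmogorov flow — unstable modes vary slowly ALONG the stream with velocity across it = the shear channel sin(2πkx₂)e₁ of this force when k < m), DubrulleFrisch1991 (doi:10.1103/physreva.43.5355: eddy viscosity of parity-invariant flow, multiscale formula, negative values), doi:10.1016/0167-2789(87)90026-1 (Frisch–She–Sulem 1987: large-scale flow driven by the anisotropic kinetic alpha effect — 3-D, non-parity-invariant forcing), doi:10.1103/PhysRevFluids.9.064605 (Xu–van Kan–Liu–Knobloch 2024: LSV-vs-jet selection of the 2-D condensate by box aspect ratio; jets = the large-scale shear modes this item must keep from braking), MusacchioBoffetta2014 = arXiv:1401.5935 §3.1 (momentum budget of the forced shear mode in DNS: friction and Reynolds-stress coefficients, G = 0 case only)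
[crux] SHEAR CHANNEL IS NOT A BRAKE: for F > 0, k m ≥ 1, any G, and every bounded-energy global LH
family driven by f_{F,G,k,m}: ∀ δ > 0, eventually in j the liminf-mean shear injection F∫ sin(2πk
x₂) u_{j,1} ≥ −δ. With G = 0 it is the LH energy inequality (injection ≥ dissipation − o(1) ≥
−o(1)); with G ≠ 0 it says the oblique channel cannot drive the forced shear mode AGAINST its force
at an O(1) rate as ν → 0. Tool: the exact Banach-limit momentum balance of the shear mode
(MeanMomentumBalanceShearMode): 4π²k²ν⟨(s,u)⟩ = F²/2 + 2πkF⟨∫u₁u₂cos(2πk x₂)⟩, so a brake needs a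
Reynolds stress exceeding the force's own momentum flux. Refuter flag on the card ('sign not free in
3-D; over-reflection') is exactly this item. -/
@[route_item "route-AnomalousDissipation-CriticalLayer", crux]
def ShearInjectionSign : Prop :=
  ∀ (F G : ℝ) (k m : ℕ) (ν : ℕ → ℝ) (u₀ : ℕ → UnitAddTorus (Fin 3) → EuclideanSpace ℝ (Fin 3)) (u : ℕ → ℝ → UnitAddTorus (Fin 3) → EuclideanSpace ℝ (Fin 3)), 0 < F → 0 < k → 0 < m → (∀ j, 0 < ν j) → Filter.Tendsto ν Filter.atTop (nhds 0) → (∀ j, Literature.Analysis.FluidPDE.Torus.IsGlobalLerayHopf (ν j) (fun _ => (fun x : UnitAddTorus (Fin 3) => (F * (UnitAddTorus.mFourier (Pi.single (1 : Fin 3) (k : ℤ)) x).im) • (EuclideanSpace.single (0 : Fin 3) (1 : ℝ) : EuclideanSpace ℝ (Fin 3)) + (G * (UnitAddTorus.mFourier (Pi.single (0 : Fin 3) (m : ℤ)) x).im) • (EuclideanSpace.single (1 : Fin 3) (1 : ℝ) : EuclideanSpace ℝ (Fin 3)))) (u₀ j) (u j)) → (∃ E : ℝ, ∀ j, Literature.Analysis.FluidPDE.meanEnergy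 (u j) ≤ E) → ∀ δ : ℝ, 0 < δ → ∀ᶠ j in Filter.atTop, -δ ≤ Literature.Analysis.FluidPDE.longTimeAvgInf (fun t => MeasureTheory.integral MeasureTheory.volume (fun x => inner ℝ ((fun x : UnitAddTorus (Fin 3) => (F * (UnitAddTorus.mFourier (Pi.single (1 : Fin 3) (k : ℤ)) x).im) • (EuclideanSpace.single (0 : Fin 3) (1 : ℝ) : EuclideanSpace ℝ (Fin 3))) x) (u j t x)))

/-- item stmt-AnomalousDissipation-14265 · crux · rank 5 · open · by planner
why it might fail: ∀ over ALL Leray–Hopf solutions at fixed ν>0: even the strong energy inequality is unknown for general weak solutions (RRS2016 §4.3 p.78; FMRT2001 p.71); false if one LH solution has an energy sink of positive time-density (rough-force LH non-uniqueness: ABC2022; leaky weaker classes: BV2019).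
sources: FoiasManleyRosaTemam2001 p.71 ('for weak solutions in dimension 3 … it is not known whether the [energy] equation is true or not'; held book chunk p0071 read 2026-08-16), (12.38)–(12.39) p.101 (automatic direction), RobinsonRodrigoSadowski2016 §4.3 p.78 (strong energy inequality 'to date is unknown for general weak solutions'; Thm 4.6: Leray–Hopf), Thm 6.5 p.101 (energy equality for strong solutions), p.135 (Sather–Serrin/Shinbrot classes) — held book, pages read 2026-08-16, CheskidovConstantinFriedlanderShvydkoy2008 Thm 1.1 = arXiv:0704.0759 (energy equality for u ∈ L³B^{1/3}_{3,c₀}), Literature.Analysis.FluidPDE.lions_energy_equality_Ioc (DuchonRobertLionsEnergyEquality.lean:954) and lions_energy_equality_L4_holds (NSGaldiEnergyEqualityHolds.lean:127): Lions/Shinbrot L⁴L⁴ class, proved in tree, DuchonRobert2000 doi:10.1088/0951-7715/13/1/312 (defect distribution D(u); D ≥ 0 for Leray–Hopf limits), arXiv:2112.03116 (Albritton–Brué–Colombo 2022, Ann. Math. 196: non-unique Leray–Hopf solutions of the FORCED Navier–Stokes equations, f ∈ L¹_t L²_x)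
[crux] Universal REGULARITY HALF of X, on the deciding chain via the glue PersistenceNoLeakageGlue
(route-choice repair 2026-08-16, option (a)). For every ν > 0, every smooth divergence-free
mean-zero steady force f on T³ and EVERY global Leray–Hopf solution u (any datum): the mean work
does not exceed the mean viscous dissipation, ⟨(f,u)⟩ ≤ ν⟨‖∇u‖²⟩ (limsup of Cesàro means). With
support #6 MeanEnergyInequalityZeroMean (the automatic direction) this is the MEAN ENERGY EQUALITY
⟨(f,u)⟩ = ν⟨‖∇u‖²⟩ — "no Leray–Hopf leakage in the mean" at positive viscosity; the rank-2 crux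
CorrelationPersistence then supplies the large-scale half with NO regularity requirement on its
family.
why it might fail: LH energy equality is open even at fixed ν (FMRT p.71; time-average measures obey
only the inequality (IV.1.31)); one LH solution leaking energy at singular epochs at a positive MEAN
rate refutes it; implied by eventual regularity, open at large Grashof.
sources: FoiasManleyRosaTemam2001 (book:foias2001-navier-stokes-equations-turbulence) PDF p.71 L22
('not known whether the [energy] equation is true or not' for 3-D weak solutions), Ch. IV Def. 1.3
(iii) (1.31) p.198 and p.210 (time-average me -/
@[route_item "route-AnomalousDissipation-CriticalLayer", crux]
def NoMeanLeakage : Prop :=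
  ∀ (ν : ℝ) (f : UnitAddTorus (Fin 3) → EuclideanSpace ℝ (Fin 3)) (u₀ : UnitAddTorus (Fin 3) → EuclideanSpace ℝ (Fin 3)) (u : ℝ → UnitAddTorus (Fin 3) → EuclideanSpace ℝ (Fin 3)), 0 < ν → Literature.Analysis.FunctionSpaces.Torus.IsSmooth f → Literature.Analysis.FunctionSpaces.Torus.IsDivFree f → Literature.Analysis.FunctionSpaces.Torus.HasZeroMean f → Literature.Analysis.FluidPDE.Torus.IsGlobalLerayHopf ν (fun _ => f) u₀ u → Literature.Analysis.FluidPDE.longTimeAvgSup (fun t => MeasureTheory.integral MeasureTheory.volume (fun x => inner ℝ (f x) (u t x))) ≤ Literature.Analysis.FluidPDE.meanDissipation ν u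

/-- item stmt-AnomalousDissipation-1014 · support · rank 5 · open · by planner
sources: book:drazin2002-introduction-hydrodynamic-stability pp.126-127, doi:10.1017/cbo9780511809064, arXiv:physics/0607270 §VI, doi:10.1017/s0022112067000515, arXiv:1711.01822, ChildressKerswellGilbert2001 §6.1 (same constant π|w_y(y₀)|⁻¹)
[support] PLEMELJ / LIMITING-ABSORPTION LEMMA (card C1, scalar model; provable now, Literature-grade
1-D analysis): U ∈ C³ 1-periodic with only simple zeros, g ∈ C¹ 1-periodic complex, a ≠ 0, b ≥ 0; if
θ_ν are C² 1-periodic solutions of i a U θ = ν(θ'' − bθ) + g with ν → 0⁺, then Re∫₀¹ conj(g) θ_ν →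
(π/|a|) Σ_{y∈[0,1), U(y)=0} |g(y)|²/|U′(y)| (finitely many zeros). Proof sketch: Re∫conj(g)θ_ν =
ν(‖θ′‖²+b‖θ‖²) ≥ 0 (energy identity); outer solution g/(iaU) is reactive; inner layer s = δσ, δ³ =
ν/(aU′_c): θ ≈ (g_c δ²/ν)W(σ), −W″ + iσW = 1, W(−σ) = conj W(σ), ∫Re W = π (Fourier: Ŵ = 2π
e^{p³/3}·1_{p<0}); matching gives the constant; regulariser-independence (damping ε instead of ν
gives |g_c|²π/|aU′_c| directly). For a = 2πm this is I(U,g) = Σ|g(y_c)|²/(2m|U′(y_c)|). Used as the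
quantitative content of TurbulentCriticalLayersAbsorb and (route SweepRigidity) of FrozenSteadyNeg. -/
@[route_item "route-AnomalousDissipation-CriticalLayer", crux]
def PlemeljAbsorption : Prop :=
  ∀ (a b : ℝ) (U : ℝ → ℝ) (g : ℝ → ℂ), a ≠ 0 → 0 ≤ b → ContDiff ℝ 3 U → ContDiff ℝ 1 g → Function.Periodic U 1 → Function.Periodic g 1 → (∀ y, U y = 0 → deriv U y ≠ 0) → ∀ (ν : ℕ → ℝ) (θ : ℕ → ℝ → ℂ), (∀ j, 0 < ν j) → Filter.Tendsto ν Filter.atTop (nhds 0) → (∀ j, ContDiff ℝ 2 (θ j) ∧ Function.Periodic (θ j) 1 ∧ ∀ y, Complex.I * (a : ℂ) * ((U y : ℝ) : ℂ) * θ j y = ((ν j : ℝ) : ℂ) * (deriv (deriv (θ j)) y - (b : ℂ) * θ j y) + g y) → Filter.Tendsto (fun j => (∫ y in (0 : ℝ)..1, (starRingEnd ℂ) (g y) * θ j y).re) Filter.atTop (nhds ((Real.pi / |a|) * ∑ᶠ y ∈ {y : ℝ | y ∈ Set.Ico (0 : ℝ) 1 ∧ U y = 0}, ‖g y‖ ^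 2 / |deriv U y|))

/-- item stmt-AnomalousDissipation-1015 · support · rank 6 · open · by planner
sources: ConstantinFoias1988, DoeringFoias2002, Mathlib UnitAddTorus.mFourier (smooth characters)
[support] The force f_{F,G,k,m} x = (F·Im mFourier(k e₂) x)•e₁ + (G·Im mFourier(m e₁) x)•e₂ is
smooth (Torus.IsSmooth: ContDiff of the lift, mFourier is a smooth character), divergence-free (each
summand varies only transversally to its direction: ∂₁ of the e₁-part and ∂₂ of the e₂-part vanish)
and mean-zero (characters with k ≠ 0 integrate to 0; for k = 0 or m = 0 the summand is identically 0
since Im 1 = 0). Needed by Assembly; provable now with Literature.Analysis.FunctionSpaces.Torus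
calculus (lift, partialDeriv, divergence_eq_trace_fderiv). -/
@[route_item "route-AnomalousDissipation-CriticalLayer", crux]
def KolmogorovObliqueForceRegular : Prop :=
  ∀ (F G : ℝ) (k m : ℕ), Literature.Analysis.FunctionSpaces.Torus.IsSmooth (fun x : UnitAddTorus (Fin 3) => (F * (UnitAddTorus.mFourier (Pi.single (1 : Fin 3) (k : ℤ)) x).im) • (EuclideanSpace.single (0 : Fin 3) (1 : ℝ) : EuclideanSpace ℝ (Fin 3)) + (G * (UnitAddTorus.mFourier (Pi.single (0 : Fin 3) (m : ℤ)) x).im) • (EuclideanSpace.single (1 : Fin 3) (1 : ℝ) : EuclideanSpace ℝ (Fin 3))) ∧ Literature.Analysis.FunctionSpaces.Torus.IsDivFree (fun x : UnitAddTorus (Fin 3) => (F * (UnitAddTorus.mFourier (Pi.single (1 : Fin 3) (k : ℤ)) x).im) • (EuclideanSpace.single (0 : Fin 3) (1 : ℝ) : EuclideanSpace ℝ (Fin 3)) + (G * (UnitAddTorus.mFourier (Pi.single (0 : Fin 3) (m : ℤ)) x).im) • (EuclideanSpace.single (1 : Fin 3) (1 : ℝ) : EuclideanSpace ℝ (Fin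 3))) ∧ Literature.Analysis.FunctionSpaces.Torus.HasZeroMean (fun x : UnitAddTorus (Fin 3) => (F * (UnitAddTorus.mFourier (Pi.single (1 : Fin 3) (k : ℤ)) x).im) • (EuclideanSpace.single (0 : Fin 3) (1 : ℝ) : EuclideanSpace ℝ (Fin 3)) + (G * (UnitAddTorus.mFourier (Pi.single (0 : Fin 3) (m : ℤ)) x).im) • (EuclideanSpace.single (1 : Fin 3) (1 : ℝ) : EuclideanSpace ℝ (Fin 3)))

/-- item stmt-AnomalousDissipation-1016 · support · rank 7 · open · by planner
sources: DoeringFoias2002 §2, FoiasManleyRosaTemam2001 Ch. IV §1, MusacchioBoffetta2014 = arXiv:1401.5935 §3.1, ChildressKerswellGilbert2001 §2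
[support] EXACT MEAN MOMENTUM BALANCE OF THE FORCED SHEAR MODE (card C4's pinning identity,
Banach-limit form; provable now): for a global LH solution u of NS_ν driven by f_{F,G,k,m} with
sup_{t≥0} kineticEnergy(u t) ≤ C (Correlation's AbsorbingBallLHTorus supplies this) and any
generalized limit Λ (Literature.Analysis.FluidPDE.GeneralizedLimit): 4π²k²ν·Λ-mean of ∫⟪F sin(2πk
x₂)e₁, u⟫ − 2πkF·Λ-mean of ∫u₁u₂cos(2πk x₂) = F²/2. Proof: test the LH weak formulation with the
time-independent divergence-free field φ = F sin(2πk x₂)e₁ (cut off in time near T), use Δφ =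
−4π²k²φ, ⟪u,(u·∇)φ⟫ = 2πkF u₁u₂cos(2πk x₂), ⟪f,φ⟫ integrates to F²/2 (the oblique part is pointwise
orthogonal), divide by T; the boundary terms (u(T),φ) − (u₀,φ) are O(1) by the energy bound, so they
vanish under Λ∘timeMean (Λ kills o(1) terms: apply_eq_of_tendsto + linearity). -/
@[route_item "route-AnomalousDissipation-CriticalLayer", crux]
def MeanMomentumBalanceShearMode : Prop :=
  ∀ (F G : ℝ) (k m : ℕ) (ν : ℝ) (u₀ : UnitAddTorus (Fin 3) → EuclideanSpace ℝ (Fin 3)) (u : ℝ → UnitAddTorus (Fin 3) → EuclideanSpace ℝ (Fin 3)) (Λ : Literature.Analysis.FluidPDE.GeneralizedLimit), 0 < ν → 0 < k → Literature.Analysis.FluidPDE.Torus.IsGlobalLerayHopf ν (fun _ => (fun x : UnitAddTorus (Fin 3) => (F * (UnitAddTorus.mFourier (Pi.single (1 : Fin 3) (k : ℤ)) x).im) • (EuclideanSpace.single (0 : Fin 3) (1 : ℝ) : EuclideanSpace ℝ (Fin 3)) + (G * (UnitAddTorus.mFourier (Pi.single (0 : Fin 3) (m : ℤ)) x).im) •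 (EuclideanSpace.single (1 : Fin 3) (1 : ℝ) : EuclideanSpace ℝ (Fin 3)))) u₀ u → (∃ C : ℝ, ∀ t : ℝ, 0 ≤ t → Literature.Analysis.FunctionSpaces.Torus.kineticEnergy (u t) ≤ C) → 4 * Real.pi ^ 2 * (k : ℝ) ^ 2 * ν * Λ.longTimeAvg (fun t => MeasureTheory.integral MeasureTheory.volume (fun x => inner ℝ ((fun x : UnitAddTorus (Fin 3) => (F * (UnitAddTorus.mFourier (Pi.single (1 : Fin 3) (k : ℤ)) x).im) • (EuclideanSpace.single (0 : Fin 3) (1 : ℝ) : EuclideanSpace ℝ (Fin 3))) x) (u t x))) - 2 * Real.pi * (k : ℝ) * F * Λ.longTimeAvg (fun t => MeasureTheory.integral MeasureTheory.volume (fun x => (u t x 0 * u t x 1) * (UnitAddTorus.mFourier (Pi.single (1 : Fin 3) (k : ℤ)) x).re)) = F ^ 2 / 2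

/-- item stmt-AnomalousDissipation-14397 · support · rank 9 · open · by planner
sources: RobinsonRodrigoSadowski2016 Def. 3.3 / Def. 4.9 and Temam1979 Ch. III Thm 3.1 (the Leray–Hopf definition being transported; LerayHopf.lean:314–352), Literature.Analysis.FluidPDE.BoundedWeakTranslate (IsBoundedWeakNSSolutionOn.comp_add_space: the R³ model of the same transport), Literature.Analysis.FunctionSpaces.Torus.mFourier_add_single (TorusAxisAverage.lean:104), Literature.Analysis.FunctionSpaces.Torus.mFourier_apply_add (TorusFourierCalculus.lean:65)
[support — provable now, Literature-grade folklore; ~250–400 lines] SPACE-TRANSLATION COVARIANCE OF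
TORUS LERAY–HOPF SOLUTIONS: if u is Leray–Hopf on [0,T) for (ν, f, u₀) then (t,x) ↦ u(t, x + a) is
Leray–Hopf on [0,T) for the translated force (t,x) ↦ f(t, x + a) and datum x ↦ u₀(x + a), for every
a ∈ T³ (hence the same for IsGlobalLerayHopf). Field by field of Torus.IsLerayHopfOn: `weak`
(IsWeakNSSolutionForcedOn: translate the test field by −a; Haar invariance
MeasureTheory.integral_add_right_eq_self on UnitAddTorus (Fin 3), which fires as is — checked rc 0
in the planner's Sketch), `energy_bound`/`memLp`/`strong_initial` (lintegral_add_right_eq_self;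
MemLp/eLpNorm of a composition with the measure-preserving translation), `memL2Sobolev` and the
eGradNormSq terms of `energy_ineq_zero/ae` (mFourierCoeff of x ↦ v(x + a) is (mFourier k a) • v̂(k)
by Literature.Analysis.FunctionSpaces.Torus.mFourier_apply_add / mFourier_add_single; unimodular
phase ⇒ every spectral (semi)norm is invariant), kineticEnergy and the force pairing (Haar
invariance), `weak_continuous` (pair with w(· − a) ∈ L²). Not in tree: only TIME translates exist
(LerayHopfRestart / LerayHopfTranslate: IsLerayHopfOn.ae -/
@[route_item "route-AnomalousDissipation-CriticalLayer", crux]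
def LerayHopfSpaceTranslation : Prop :=
  ∀ (T ν : ℝ) (f : ℝ → UnitAddTorus (Fin 3) → EuclideanSpace ℝ (Fin 3)) (u₀ : UnitAddTorus (Fin 3) → EuclideanSpace ℝ (Fin 3)) (u : ℝ → UnitAddTorus (Fin 3) → EuclideanSpace ℝ (Fin 3)) (a : UnitAddTorus (Fin 3)), Literature.Analysis.FluidPDE.Torus.IsLerayHopfOn T ν f u₀ u → Literature.Analysis.FluidPDE.Torus.IsLerayHopfOn T ν (fun t x => f t (x + a)) (fun x => u₀ (x + a)) (fun t x => u t (x + a))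

/-- item stmt-AnomalousDissipation-14398 · support · rank 9 · open · by planner
sources: this route: stmt-AnomalousDissipation-1011, -1013, -1015 and the two items added with it; DoeringFoias2002 §2 (injection–dissipation bookkeeping)
[support — GLUE Crux… → Target (route-choice repair 2026-08-16, option (a)); provable now,
elementary] THE CRUXES GIVE THESIS X. Proof plan (every micro-step below was elaborated rc 0 in the
planner's Sketch.lean): (0) SIGN NORMALISATION. Take the TurbulentCriticalLayersAbsorb witness
(F,G,k,m,ν,u₀,u,E,ε). If F < 0 put a := Pi.single (1 : Fin 3) ↑((1:ℝ)/2/k) and replace u₀ j, u j t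
by their translates x ↦ ·(x + a): by LerayHopfSpaceTranslation (T by T) they are global Leray–Hopf
for the force x ↦ f_{F,G,k,m}(x + a) = f_{−F,G,k,m}(x) (funext;
Literature.MathematicalPhysics.KineticTheory.mFourier_add_single_half flips the (k e₂)-character —
checked; the (m e₁)-character is unchanged because a has zero 0-th coordinate:
Literature.Analysis.FunctionSpaces.Torus.mFourier_add_single + Pi.single_eq_of_ne + fourier at 0),
while meanEnergy and the oblique pairing t ↦ ∫⟪g_{G,m}, u j t (· + a)⟫ are unchanged
(MeasureTheory.integral_add_right_eq_self on T³ — checked — after rewriting g_{G,m}(x) = g_{G,m}(x +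
a)). So WLOG 0 ≤ F with all TCLA clauses and the same E, ε. (1) SHEAR SIGN. If 0 < F:
ShearInjectionSign with δ := ε/2 gives ∀ᶠ j in atTop, −(ε/2) ≤ longTimeAvgInf (shear pairing j);
extrac -/
@[route_item "route-AnomalousDissipation-CriticalLayer", crux]
def CruxesGiveThesis : Prop :=
  TurbulentCriticalLayersAbsorb → ShearInjectionSign → NoMeanLeakage → KolmogorovObliqueForceRegular → LerayHopfSpaceTranslation → KolmogorovObliqueThesis

/-- item stmt-AnomalousDissipation-1017 · assembly · rank 1 · open · by planner
sources: DoeringFoias2002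
[assembly] KolmogorovObliqueThesis → AnomalousDissipation. Unfold AnomalousDissipation =
Literature.Turb.ZerothLaw; take f := f_{F,G,k,m} (smooth/div-free/mean-zero by
KolmogorovObliqueForceRegular — may be re-proved inline or taken from that item once landed), ν, u₀,
u from X. Energy clause verbatim. Dissipation: for each j, timeMean of t ↦ ∫⟪f,u_j t⟫ =
timeMean(shear pairing) + timeMean(oblique pairing) for T > 0 (integral_add: both pairings are
continuous on (0,T] by (IsGlobalLerayHopf → IsLerayHopfOn).weak_continuous with w = the smooth force
parts ∈ L², and bounded near 0, hence interval integrable); limsup(a+b) ≥ liminf a + limsup b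
(Filter.le_limsup_add / limsup_add_ge with boundedness from |pairing| ≤ ‖φ‖₂·(2 kineticEnergy)^{1/2}
and the LH energy bound) gives longTimeAvgSup⟨f,u_j⟩ ≥ −ε/2 + ε = ε/2; clause (ii) then gives
meanDissipation (ν j) (u j) ≥ ε/2 > 0. -/
@[route_item "route-AnomalousDissipation-CriticalLayer", crux]
def Assembly : Prop :=
  KolmogorovObliqueThesis → AnomalousDissipation

/-! D-0027 §2.1 — DECIDING THEOREM (planner-authored via `route open/edit --closes-file`; by planner-rchoice-AnomalousDissipation-CriticalL-54aabeb6-0 2026-08-16T03:22:06Z):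
its hypotheses are this route's items and its conclusion the sub-problem Statement (glue_lint), and it elaborates with this file. -/

@[closes "route-AnomalousDissipation-CriticalLayer"] theorem closes
    (h_KolmogorovObliqueThesis : KolmogorovObliqueThesis)
    (h_TurbulentCriticalLayersAbsorb : TurbulentCriticalLayersAbsorb)
    (h_PlanarCatsEyeDodging : PlanarCatsEyeDodging)
    (h_ShearInjectionSign : ShearInjectionSign)
    (h_PlemeljAbsorption : PlemeljAbsorption)
    (h_KolmogorovObliqueForceRegular : KolmogorovObliqueForceRegular)
    (h_MeanMomentumBalanceShearMode : MeanMomentumBalanceShearMode)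
    (h_Assembly : Assembly)
    (h_NoMeanLeakage : NoMeanLeakage)
    (h_LerayHopfSpaceTranslation : LerayHopfSpaceTranslation)
    (h_CruxesGiveThesis : CruxesGiveThesis) : _root_.AnomalousDissipation :=
  h_Assembly (h_CruxesGiveThesis h_TurbulentCriticalLayersAbsorb h_ShearInjectionSign h_NoMeanLeakage
    h_KolmogorovObliqueForceRegular h_LerayHopfSpaceTranslation)

end Summit.AnomalousDissipation.AnomalousDissipation.Theses.CriticalLayer
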